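import Summits.QuantumFields.BalabanUV.Beta.FP.TorusNestedReadoutLocality
import Summits.QuantumFields.BalabanUV.Beta.GAN24.SymContactFaceJump
import Summits.QuantumFields.BalabanUV.Beta.GAN24.SymLinKernelExpansion

/-!
# `BalabanUV.Beta.FP.QstepSymTwoBlock` — road «FP», binder row D1, ROUTE T (β1), STUB P (P-b) of the row's ONE file, part 3 (R-AN2-76-PB): **THE TWO-BLOCK LETTER (TB)
# DISCHARGED AT THE RECORD's (0.4)-SYMMETRISED ONE-STEP ROWS `QSym Lc`**, hence `FP/TorusNestedReadoutLocality`'s locality of the nested-slice gauge read-out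
# UNCONDITIONAL at the wrapper's `compRowsSym`

WHY.  `FP/TorusNestedReadoutRows` ∕ `…Locality` (this lineage, parts 1–2) prove the locality of the wrapper's tree-gauge read-out `E·(N·W₀)⁻¹·N` over a GENERIC one-step
family `Q : StepRows d Lc` under ONE displayed letter (TB): «for a NON-WRAPPING coarse bond `(a, ν)` (`↑a + e_ν ∈ pbox M`), `Q M ℓ r (a,ν) (b,κ) ≠ 0` only if both endpoints of the
fine bond `(b, κ)` lie under the blocks `a`, `a + e_ν`».  At the record (R-D1-g52-1: the (0.4)-symmetrised tower) `Q := QSym Lc`, `QSym Lc M ℓ _ = QstepSym Lc M ℓ =` the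
`(coarsePt, inr) × (·, inl)` block of `perF (fine Lc M) (bhKStepSh d Lc (Dsh Lc) ℓ)` (leaf-06 g32).  This file DISCHARGES (TB) there: §1 the `(inr, inl)` block of an1's shifted
straight spread is `stepScale ℓ ·` that of `bhK + Dsh`, i.e. `((d+1)!)⁻¹ · symLinAvgAt ρ_c (delta1 κ z) Lc ν (quo Lc x)` at the coarse points (`DshAn1.bhK_add_Dsh_inr_inl`);
§2 the symmetrised rooted averaging of a bond indicator is the symmetrised COUNT of that bond (gan24-leaf-01's `symLinAvgAt_eq_sum_symLinCountAt`), which has the two-block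
support (gan24-leaf-01's `symLinCountAt_eq_zero_of_not_twoBlock`: both endpoints of every bond of every word of the coarse bond `(ν, a)` have block label `a` or `a + e_ν`);
§3 the periodisation sum: a copy `translate (fine Lc M) b m` whose block is a box point IS `b` (`translate_eq_self_of_quo_mem` — the copy index vanishes because both blocks
`a`, `a + e_ν` are box points), so **`QSym_twoBlock`** = (TB) at `QSym Lc`; §4 the three locality theorems of part 2 at `hQ₁₀ : Q₁₀ = compRowsSym Lc M lev rs (n+1)` (g53 (D)
§2's ∕ leaf-06 G-2's letter VERBATIM) with (TB) discharged: **`readout_apply_ne_zero_sym`**, **`readout_mulVec_apply_congr_sym`**, **`treeGauge_readout_congr_sym`** —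
STUB P (P-b) UNCONDITIONAL AT THE RECORD: «the END wrapper's tree-gauge read-out `lv v s` (v10's `hlve`; `θ_v` by (D), invertibility by G-2) depends on the one-shot chart
column only through the finest bonds with both endpoints in the big block `quo (Lc^{n+2}) ↑s`».

WHAT ([folklore] finite-sum bookkeeping BY NAME; no `def`, no `def … : Prop`, nothing cited, 0 sorry, default heartbeats).  WHAT THIS IS NOT: not (P-c) (the lattice twin
`λℤ`, its `Mc B`-periodisation = `lv` — the row's); not the VALUE identification «block of the general-box read-out = reference-torus read-out» (J-NOTE-20 §8; next file of
this lineage); the rooted `Qstep Lc` twin of (TB) (`linCountAt_eq_zero_of_not_twoBlock`) not typed (the record is the sym tower); `hlve` NOT instantiated; no row of v9∕v10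
discharged; nothing of Bałaban's asserted, valued or discharged; 0 estimates; 0∕4 row-D1 binders (hW, hR, D1Tel, D1Rep); ROOT M‴ p325680 untouched; NOT (C1), NOT (L2′),
NOT (T-ID), NOT SDF, NOT D1, NEVER «G-an2-4 closed», NOT BetaPertH, NOT continuum, NOT Clay.

HONEST DEPENDENCY (page 1, mandatory): continuum YM on T⁴ ⇐ BetaPertH ∧ nine spine estimates (0/9 proved); BetaPertH ⇐ (D1) ∧ (D4) ∧ CAP+tail;
G-an2-4 gates asym, D1 and NE2/3/4.  HONEST FRAMING (cell contract, verbatim): «discharging `BetaPertH` makes Bałaban's UV stability UNCONDITIONAL —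
a real constructive-QFT result; it is NOT the continuum limit and NOT the Clay problem.»  ABSOLUTE RULE (cell charter, verbatim): «No internally-minted
statement may enter as a cited fact. Every hypothesis is either kernel-proved in this package or a verbatim quotation of a PUBLISHED theorem with page
reference. The manuscript(s) under audit are NOT citable for their own disputed steps — they are the thing under adjudication; programme-internal
(2001/route/tribunal) claims are never citable.»  Road «FP» OWNER, b2b-balaban-beta-d1-p3 gen 54, 2026-08-29.  No existing file touched.
-/

noncomputable section

namespace Summit.QuantumFields.BalabanUV.Beta.FP.QstepSymTwoBlock

open Matrix Finset
open scoped BigOperators Nat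
open Literature.Probability.LatticeModels (Torus.proj)
open Literature.MathematicalPhysics.QuantumFieldTheory
open Literature.MathematicalPhysics.QuantumFieldTheory.Balaban1983to89
open Literature.MathematicalPhysics.QuantumFieldTheory.Balaban1983to89.Beta
open B5Prop11Plancherel (fine)
open B6Lemma24Torus (pbox mem_pbox)
open AffineAveraging (Site box toSite unitVec)
open AveragingContours (blk)
open AveragingContoursRooted (ctr ctrOff ctrOff_mem_box)
open KKTFluctuationKernel (delta1 delta1_apply)
open OneStepResolventKernel (Fib quo_zsmul)
open Literature.MathematicalPhysics.QuantumFieldTheory.LatticeForm (quo)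
open B4TorusKernel.MultiPeriod (translate)
open Summit.QuantumFields.BalabanUV.Beta.BorderedHessian (bhK bhKStep bhKStep_zero bhKStep_succ_inr_inl stepScale)
open Summit.QuantumFields.BalabanUV.Beta.SymShiftedSpread (bhKStepSh bhKStepSh_apply)
open Summit.QuantumFields.BalabanUV.Beta.DshAn1 (Dsh bhK_add_Dsh_inr_inl)
open Summit.QuantumFields.BalabanUV.Beta.SymmetrisedAxialPotential (symLinAvgAt)
open Summit.QuantumFields.BalabanUV.Beta.SymAveragingHessianCounts (symLinCountAt)
open Summit.QuantumFields.BalabanUV.Beta.GAN24.SymContactFaceJump (symLinCountAt_eq_zero_of_not_twoBlock)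
open Summit.QuantumFields.BalabanUV.Beta.GAN24.SymLinKernelExpansion (symLinAvgAt_eq_sum_symLinCountAt)
open Summit.QuantumFields.BalabanUV.Beta.FP.KernelPeriodisationFib (Idx perF perF_apply perZ_apply translate_eq_add)
open Summit.QuantumFields.BalabanUV.Beta.FP.TorusGaugeCovarianceCoarse (coarsePt coarsePt_coe proj_coarsePt)
open Summit.QuantumFields.BalabanUV.Beta.FP.TorusCombRows (Res)
open Summit.QuantumFields.BalabanUV.Beta.FP.TorusCombNestedBasis (quo_mem_pbox)
open Summit.QuantumFields.BalabanUV.Beta.FP.TorusCompositeObjects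
open Summit.QuantumFields.BalabanUV.Beta.FP.TorusCompositeObjectsG (StepRows compRowsG QstepSym QSym compRowsSym)
open Summit.QuantumFields.BalabanUV.Beta.FP.TorusCompositeUnimodular (towerEvalC)
open Summit.QuantumFields.BalabanUV.Beta.FP.TorusNestedReadoutLocality

variable {d : ℕ}

/-! ## §1 The multiplier–field entries of the shifted straight spread: `stepScale ℓ ·` the (0.4)-symmetrised rooted averaging of the bond indicator -/

section Spread

variable (Lc : ℕ) [NeZero Lc]

/-- [folklore] **THE `(inr, inl)` BLOCK OF `bhKStepSh d Lc (Dsh Lc) ℓ`** is `stepScale d Lc ℓ ·` that of `bhK Lc + Dsh Lc` — at the coarse points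
`((d+1)!)⁻¹ · symLinAvgAt ρ_c (delta1 β y) Lc m (quo Lc x)` (`DshAn1.bhK_add_Dsh_inr_inl`), zero elsewhere. -/
theorem bhKStepSh_Dsh_inr_inl_symLinAvgAt (ℓ : ℕ) (x y : Fin (d + 1) → ℤ) (m β : Fin (d + 1)) :
    bhKStepSh d Lc (Dsh Lc) ℓ x y (Sum.inr m) (Sum.inl β)
      = stepScale d Lc ℓ * (if Torus.proj Lc x = 0 then ((d + 1)! : ℝ)⁻¹ * symLinAvgAt (ctr (d + 1) Lc) (delta1 β y) Lc m (quo Lc x) else 0) := by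
  rw [← bhK_add_Dsh_inr_inl, bhKStepSh_apply, Pi.add_apply, Pi.add_apply, Pi.add_apply, Pi.add_apply,
    Pi.smul_apply, Pi.smul_apply, Pi.smul_apply, Pi.smul_apply, smul_eq_mul, Pi.add_apply, Pi.add_apply, Pi.add_apply, Pi.add_apply, mul_add]
  cases ℓ with
  | zero =>
    have h1 : stepScale d Lc 0 = 1 := by simp [stepScale]
    rw [bhKStep_zero, h1, one_mul, one_mul]
  | succ j => rw [bhKStep_succ_inr_inl]

end Spread

/-! ## §2 The symmetrised rooted averaging of a bond indicator has the two-block support (gan24-leaf-01's `symLinCountAt_eq_zero_of_not_twoBlock`) -/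

section TwoBlock

/-- [folklore] **`symLinAvgAt ρ (delta1 β z) L m X ≠ 0 ⟹ BOTH ENDPOINTS OF THE BOND `(β, z)` LIE IN THE BLOCKS `X`, `X + e_m`** (box root `ρ = toSite r`): the symmetrised
rooted averaging of a bond indicator is the symmetrised count of that bond (`symLinAvgAt_eq_sum_symLinCountAt`), which has the two-block support. -/
theorem symLinAvgAt_delta1_ne_zero {L : ℕ} (hL : 1 ≤ L) {r : Fin (d + 1) → ℕ} (hr : r ∈ box (d + 1) L) (β : Fin (d + 1)) (z : Site (d + 1))
    (m : Fin (d + 1)) (X : Site (d + 1)) (h : symLinAvgAt (toSite r) (delta1 β z) L m X ≠ 0) :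
    (quo L z = X ∨ quo L z = X + unitVec m) ∧ (quo L (z + unitVec β) = X ∨ quo L (z + unitVec β) = X + unitVec m) := by
  by_contra hnot
  apply h
  rw [symLinAvgAt_eq_sum_symLinCountAt hr]
  refine Finset.sum_eq_zero fun x _ => Finset.sum_eq_zero fun α _ => ?_
  rw [delta1_apply]
  split_ifs with hαx
  · obtain ⟨rfl, rfl⟩ := hαx
    rw [symLinCountAt_eq_zero_of_not_twoBlock hL hr (f := (α, x)) hnot, Int.cast_zero, zero_mul]
  · rw [mul_zero]

end TwoBlock

/-! ## §3 (TB) at the record's (0.4)-symmetrised one-step rows `QSym Lc` -/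

section Record

variable (Lc : ℕ) [NeZero Lc]

/-- [folklore] a fine point congruent to a fine-box point modulo the fine torus, whose block is a coarse-box point, IS that fine-box point (the copy index vanishes). -/
theorem translate_eq_self_of_quo_mem {N : ℕ} (hN : 0 < N) {M : Fin (d + 1) → ℕ} {b : Site (d + 1)} (hb : b ∈ pbox (fine N M)) (mv : Fin (d + 1) → ℤ)
    (hq : quo N (translate (fine N M) b mv) ∈ pbox M) : translate (fine N M) b mv = b := by
  have hqb : quo N b ∈ pbox M := quo_mem_pbox hN hb
  rw [mem_pbox] at hq hqb
  rw [translate_eq_add]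
  funext i
  have hN0 : (N : ℤ) ≠ 0 := by exact_mod_cast hN.ne'
  have e : quo N (translate (fine N M) b mv) i = quo N b i + (M i : ℤ) * mv i := by
    show (translate (fine N M) b mv) i / (N : ℤ) = b i / (N : ℤ) + (M i : ℤ) * mv i
    rw [translate_eq_add]
    simp only [Pi.add_apply, fine, Nat.cast_mul]
    rw [show b i + (N : ℤ) * (M i : ℤ) * mv i = b i + (N : ℤ) * ((M i : ℤ) * mv i) by ring, Int.add_mul_ediv_left _ _ hN0]
  have h1 := hq i
  have h2 := hqb i
  rw [e] at h1
  have hm : mv i = 0 := by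
    rcases lt_trichotomy (mv i) 0 with hlt | heq | hgt
    · nlinarith [h1.1, h2.2]
    · exact heq
    · nlinarith [h1.2, h2.1]
  simp only [Pi.add_apply, hm, mul_zero, add_zero]

/-- [folklore] **(TB) — THE TWO-BLOCK SUPPORT OF THE RECORD's ONE-STEP ROWS ON NON-WRAPPING COARSE BONDS**: for `QSym Lc` (leaf-06 g32's `QstepSym` = the periodised
`(inr, inl)` block of an1's shifted straight spread `bhKStepSh d Lc (Dsh Lc) ℓ` between the coarse points and the fine field slots), if `↑a + e_ν ∈ pbox M` and
`QSym Lc M ℓ r (a, ν) (b, κ) ≠ 0` then `quo Lc ↑b ∈ {↑a, ↑a + e_ν}` and `quo Lc (↑b + e_κ) ∈ {↑a, ↑a + e_ν}` — §1, §2 on each copy of the periodisation sum, and the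
copies `m ≠ 0` die because both blocks are box points (`translate_eq_self_of_quo_mem`). -/
theorem QSym_twoBlock (M : Fin (d + 1) → ℕ) [∀ μ, NeZero (M μ)] (ℓ : ℕ) (r : Fin (d + 1) → ℕ) (a : ↥(pbox M)) (ν : Fin (d + 1))
    (b : ↥(pbox (fine Lc M))) (κ : Fin (d + 1)) (ha : (a : Site (d + 1)) + unitVec ν ∈ pbox M) (h : QSym Lc M ℓ r (a, ν) (b, κ) ≠ 0) :
    (quo Lc (b : Site (d + 1)) = a ∨ quo Lc (b : Site (d + 1)) = (a : Site (d + 1)) + unitVec ν) ∧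
      (quo Lc ((b : Site (d + 1)) + unitVec κ) = a ∨ quo Lc ((b : Site (d + 1)) + unitVec κ) = (a : Site (d + 1)) + unitVec ν) := by
  have hLc : 0 < Lc := Nat.pos_of_ne_zero (NeZero.ne Lc)
  have hL1 : 1 ≤ Lc := hLc
  -- the entry is the periodisation sum of the spread's `(inr ν, inl κ)` entries at the coarse point `Lc • a`
  have h' : (∑' mv : Fin (d + 1) → ℤ, bhKStepSh d Lc (Dsh Lc) ℓ ((Lc : ℤ) • (a : Site (d + 1))) (translate (fine Lc M) (b : Site (d + 1)) mv)
      (Sum.inr ν) (Sum.inl κ)) ≠ 0 := by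
    have e : QSym Lc M ℓ r (a, ν) (b, κ) = perF (fine Lc M) (bhKStepSh d Lc (Dsh Lc) ℓ) (coarsePt M Lc a, Sum.inr ν) (b, Sum.inl κ) := rfl
    rw [e, perF_apply, perZ_apply, coarsePt_coe] at h
    exact h
  -- some copy is nonzero
  have hnall : ¬ ∀ mv : Fin (d + 1) → ℤ, bhKStepSh d Lc (Dsh Lc) ℓ ((Lc : ℤ) • (a : Site (d + 1))) (translate (fine Lc M) (b : Site (d + 1)) mv)
      (Sum.inr ν) (Sum.inl κ) = 0 := fun hall => h' (by simp only [hall, tsum_zero])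
  obtain ⟨mv, hmv⟩ := not_forall.mp hnall
  rw [bhKStepSh_Dsh_inr_inl_symLinAvgAt, if_pos (OneStepResolventKernel.proj_zsmul (a : Site (d + 1))), quo_zsmul] at hmv
  have hsym : symLinAvgAt (ctr (d + 1) Lc) (delta1 κ (translate (fine Lc M) (b : Site (d + 1)) mv)) Lc ν (a : Site (d + 1)) ≠ 0 := by
    intro h0; apply hmv; rw [h0, mul_zero, mul_zero]
  have two := symLinAvgAt_delta1_ne_zero hL1 (ctrOff_mem_box (d := d + 1) hL1) κ _ ν (a : Site (d + 1)) hsym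
  -- the copy index vanishes: the block of the copy is a box point
  have hq : quo Lc (translate (fine Lc M) (b : Site (d + 1)) mv) ∈ pbox M := by
    rcases two.1 with e | e <;> rw [e]
    · exact a.2
    · exact ha
  rw [translate_eq_self_of_quo_mem hLc b.2 mv hq] at two
  exact two

end Record

/-! ## §4 The locality theorems of `FP/TorusNestedReadoutLocality` at the record's `compRowsSym`, (TB) discharged -/

section RecordReadout

variable (Lc : ℕ) [NeZero Lc] (M : Fin (d + 1) → ℕ) [∀ μ, NeZero (M μ)] (lev : ℕ → ℕ) (rs : ℕ → (Fin (d + 1) → ℕ))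
  (hrs : ∀ k i, 0 ≤ toSite (rs k) i ∧ toSite (rs k) i < (Lc : ℤ)) (hM : ∀ i, Lc ∣ M i) (n : ℕ)
include hM

/-- **STUB P (P-b) AT THE RECORD, support form** — `FP/TorusNestedReadoutLocality.readout_apply_ne_zero` with `Q₁₀ = compRowsSym Lc M lev rs (n+1)` (the wrapper's composite
averaging of record, g53 (D) §2's `hQ₁₀` VERBATIM) and (TB) DISCHARGED (`QSym_twoBlock`): every nonzero entry `(E·(N·W₀)⁻¹·N) p b` has both endpoints of the finest bond `b`
in the big block `quo (bigRatio Lc (n+1)) (site of p)`. -/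
theorem readout_apply_ne_zero_sym
    {Q₁₀ : Matrix (↥(pbox M) × Fin (d + 1)) (↥(pbox (towerTorus Lc M (n + 1))) × Fin (d + 1)) ℝ} (hQ₁₀ : Q₁₀ = compRowsSym Lc M lev rs (n + 1))
    {τ₁ : Matrix (NParam Lc (fine Lc M) (fun k => rs (k + 1)) n) (↥(pbox (towerTorus Lc M (n + 1))) × Fin (d + 1)) ℝ}
    (hτ₁ : τ₁ = bigP Lc (fine Lc M) (fun k => rs (k + 1)) (fun k => hrs (k + 1)) n)
    {τ₂ : Matrix (Res (toSite (rs 0)) Lc M) (↥(pbox M) × Fin (d + 1)) ℝ} (hτ₂ : τ₂ = combF Lc M (rs 0))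
    {N : Matrix (NParam Lc M rs (n + 1)) (↥(pbox (towerTorus Lc M (n + 1))) × Fin (d + 1)) ℝ} (hN : N = Matrix.fromRows (τ₂ * Q₁₀) τ₁)
    {W₀ : Matrix (↥(pbox (towerTorus Lc M (n + 1))) × Fin (d + 1)) (NParam Lc M rs (n + 1)) ℝ} (hW₀ : W₀ = towerGen Lc M rs (n + 1))
    {E : Matrix (NParam Lc M rs (n + 1)) (NParam Lc M rs (n + 1)) ℝ} (hE : E = towerEvalC Lc M rs hrs (n + 1))
    (p : NParam Lc M rs (n + 1)) (b : ↥(pbox (towerTorus Lc M (n + 1))) × Fin (d + 1)) (h : (E * (N * W₀)⁻¹ * N) p b ≠ 0) :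
    quo (bigRatio Lc (n + 1)) (b.1 : Site (d + 1)) = quo (bigRatio Lc (n + 1)) ((towerEquiv Lc M rs hrs (n + 1)).symm p).site ∧
      quo (bigRatio Lc (n + 1)) ((b.1 : Site (d + 1)) + unitVec b.2) = quo (bigRatio Lc (n + 1)) ((towerEquiv Lc M rs hrs (n + 1)).symm p).site :=
  readout_apply_ne_zero Lc (QSym Lc) (QSym_twoBlock Lc) M lev rs hrs hM n hQ₁₀ hτ₁ hτ₂ hN hW₀ hE p b h

/-- **STUB P (P-b) AT THE RECORD, `mulVec` form**: the read-out `(E·(N·W₀)⁻¹·N) *ᵥ X` at slot `p` depends on the column `X` only through the finest bonds with both endpoints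
in `p`'s big block. -/
theorem readout_mulVec_apply_congr_sym
    {Q₁₀ : Matrix (↥(pbox M) × Fin (d + 1)) (↥(pbox (towerTorus Lc M (n + 1))) × Fin (d + 1)) ℝ} (hQ₁₀ : Q₁₀ = compRowsSym Lc M lev rs (n + 1))
    {τ₁ : Matrix (NParam Lc (fine Lc M) (fun k => rs (k + 1)) n) (↥(pbox (towerTorus Lc M (n + 1))) × Fin (d + 1)) ℝ}
    (hτ₁ : τ₁ = bigP Lc (fine Lc M) (fun k => rs (k + 1)) (fun k => hrs (k + 1)) n)
    {τ₂ : Matrix (Res (toSite (rs 0)) Lc M) (↥(pbox M) × Fin (d + 1)) ℝ} (hτ₂ : τ₂ = combF Lc M (rs 0))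
    {N : Matrix (NParam Lc M rs (n + 1)) (↥(pbox (towerTorus Lc M (n + 1))) × Fin (d + 1)) ℝ} (hN : N = Matrix.fromRows (τ₂ * Q₁₀) τ₁)
    {W₀ : Matrix (↥(pbox (towerTorus Lc M (n + 1))) × Fin (d + 1)) (NParam Lc M rs (n + 1)) ℝ} (hW₀ : W₀ = towerGen Lc M rs (n + 1))
    {E : Matrix (NParam Lc M rs (n + 1)) (NParam Lc M rs (n + 1)) ℝ} (hE : E = towerEvalC Lc M rs hrs (n + 1))
    (p : NParam Lc M rs (n + 1)) (X X' : ↥(pbox (towerTorus Lc M (n + 1))) × Fin (d + 1) → ℝ)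
    (hX : ∀ b : ↥(pbox (towerTorus Lc M (n + 1))) × Fin (d + 1),
      quo (bigRatio Lc (n + 1)) (b.1 : Site (d + 1)) = quo (bigRatio Lc (n + 1)) ((towerEquiv Lc M rs hrs (n + 1)).symm p).site →
      quo (bigRatio Lc (n + 1)) ((b.1 : Site (d + 1)) + unitVec b.2) = quo (bigRatio Lc (n + 1)) ((towerEquiv Lc M rs hrs (n + 1)).symm p).site →
        X b = X' b) :
    ((E * (N * W₀)⁻¹ * N) *ᵥ X) p = ((E * (N * W₀)⁻¹ * N) *ᵥ X') p :=
  readout_mulVec_apply_congr Lc (QSym Lc) (QSym_twoBlock Lc) M lev rs hrs hM n hQ₁₀ hτ₁ hτ₂ hN hW₀ hE p X X' hX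

/-- **STUB P (P-b) AT THE RECORD, THE WRAPPER's SHAPE** (g53 (D) `gaugeParam_eq_neg_nestedReadout_sym`'s conclusion shape `(N·W₀)·θ = −N·X`, leaf-06 G-2
`torus_hTW_oneShot_towerSym`'s `det (N·W₀) ≠ 0`, v10's `hlve` word): if `X = X′` on the finest bonds with BOTH endpoints in the big block `quo (Lc^{n+2}) ↑s` of the finest
site `s`, then `Σ_{x : Res} [x.1 = s]·(E *ᵥ θ)(towerEquiv x) = Σ_x [x.1 = s]·(E *ᵥ θ′)(towerEquiv x)` — «`lv v s` depends on the chart column only through the bonds INSIDE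
`s`'s big block», UNCONDITIONALLY at the record's (0.4)-symmetrised tower. -/
theorem treeGauge_readout_congr_sym
    {Q₁₀ : Matrix (↥(pbox M) × Fin (d + 1)) (↥(pbox (towerTorus Lc M (n + 1))) × Fin (d + 1)) ℝ} (hQ₁₀ : Q₁₀ = compRowsSym Lc M lev rs (n + 1))
    {τ₁ : Matrix (NParam Lc (fine Lc M) (fun k => rs (k + 1)) n) (↥(pbox (towerTorus Lc M (n + 1))) × Fin (d + 1)) ℝ}
    (hτ₁ : τ₁ = bigP Lc (fine Lc M) (fun k => rs (k + 1)) (fun k => hrs (k + 1)) n)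
    {τ₂ : Matrix (Res (toSite (rs 0)) Lc M) (↥(pbox M) × Fin (d + 1)) ℝ} (hτ₂ : τ₂ = combF Lc M (rs 0))
    {N : Matrix (NParam Lc M rs (n + 1)) (↥(pbox (towerTorus Lc M (n + 1))) × Fin (d + 1)) ℝ} (hN : N = Matrix.fromRows (τ₂ * Q₁₀) τ₁)
    {W₀ : Matrix (↥(pbox (towerTorus Lc M (n + 1))) × Fin (d + 1)) (NParam Lc M rs (n + 1)) ℝ} (hW₀ : W₀ = towerGen Lc M rs (n + 1))
    {E : Matrix (NParam Lc M rs (n + 1)) (NParam Lc M rs (n + 1)) ℝ} (hE : E = towerEvalC Lc M rs hrs (n + 1))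
    (hTW : (N * W₀).det ≠ 0)
    {θ θ' : NParam Lc M rs (n + 1) → ℝ} {X X' : ↥(pbox (towerTorus Lc M (n + 1))) × Fin (d + 1) → ℝ}
    (hθ : (N * W₀) *ᵥ θ = -(N *ᵥ X)) (hθ' : (N * W₀) *ᵥ θ' = -(N *ᵥ X'))
    (s : ↥(pbox (towerTorus Lc M (n + 1))))
    (hX : ∀ b : ↥(pbox (towerTorus Lc M (n + 1))) × Fin (d + 1),
      quo (bigRatio Lc (n + 1)) (b.1 : Site (d + 1)) = quo (bigRatio Lc (n + 1)) (s : Site (d + 1)) →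
      quo (bigRatio Lc (n + 1)) ((b.1 : Site (d + 1)) + unitVec b.2) = quo (bigRatio Lc (n + 1)) (s : Site (d + 1)) → X b = X' b) :
    (∑ x : Res (bigRoot Lc rs (n + 1)) (bigRatio Lc (n + 1)) (towerTorus Lc M (n + 1)),
        (if (x.1 : ↥(pbox (towerTorus Lc M (n + 1)))) = s then (E *ᵥ θ) (towerEquiv Lc M rs hrs (n + 1) x) else 0))
      = ∑ x : Res (bigRoot Lc rs (n + 1)) (bigRatio Lc (n + 1)) (towerTorus Lc M (n + 1)),
        (if (x.1 : ↥(pbox (towerTorus Lc M (n + 1)))) = s then (E *ᵥ θ') (towerEquiv Lc M rs hrs (n + 1) x) else 0) :=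
  treeGauge_readout_congr Lc (QSym Lc) (QSym_twoBlock Lc) M lev rs hrs hM n hQ₁₀ hτ₁ hτ₂ hN hW₀ hE hTW hθ hθ' s hX

end RecordReadout

end Summit.QuantumFields.BalabanUV.Beta.FP.QstepSymTwoBlock

end
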